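import Summits.Langlands.Langlands.Theses.ExteriorSquareAscent
import HarnessLib

/-!
# `PairLPoleJS` — negative lane: the hypothesis `Re s₀ = 1` is redundant

Refuter-side information for the crux `PairLPoleJS` (item stmt-Langlands-19093; Arthur–Clozel Ch. 3 §2
(2.3) for Borel–Jacquet data), cycle 1 of the standing disprover (`Cruxes/PairLPoleJS/Disproof.lean` §(b)):
the hypothesis `hs₀ : s₀.re = 1` of the crux is IMPLIED by the others. If `α`, `β` are unitary off a finite
`S` (`|∏ α_w| = |∏ β_w| = 1`), `card α_w = n > 0` off `S` (for Satake parameters: `HasSatakeParamAt.card_eq`)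
and `s₀ ∈ X` (`q_w^{1-s₀} α_w = β_w⁻¹` as multisets for almost all `w`), then at a single place `w ∉ S`
where `X` holds, products and norms give `q_w^{(1 - Re s₀) n} = 1` with `q_w > 1`, whence `Re s₀ = 1`
(`re_eq_one_of_satakeX`). No statement of the route is proved or refuted.
-/

noncomputable section

set_option linter.dupNamespace false -- project-wide option (lakefile weak.linter.dupNamespace); `Summit.Langlands.Langlands` is the mandated namespace


open scoped Topology
open NumberField IsDedekindDomain MeasureTheory Filter
open Literature.NumberTheory.Automorphic AdelicGroupData
open Literature.NumberTheory.GaloisRepresentations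

namespace Summit.Langlands.Langlands.Theorems.PairLPoleJS.Negative

/-- A number field has infinitely many finite places (a prime of `𝓞 F` above every rational prime; local
copy of the tree's `Literature.NumberTheory.Automorphic.infinite_heightOneSpectrum` of
`JacquetLanglandsParts`, to keep the imports of this file to the route file). [folklore] -/
private theorem infinite_heightOneSpectrum_aux (F : Type) [Field F] [NumberField F] :
    Infinite (HeightOneSpectrum (𝓞 F)) := by
  classical
  have hinj : Function.Injective (algebraMap ℤ (𝓞 F)) := (algebraMap ℤ (𝓞 F)).injective_int
  have key : ∀ p : Nat.Primes, ∃ w : HeightOneSpectrum (𝓞 F),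
      w.asIdeal.comap (algebraMap ℤ (𝓞 F)) = Ideal.span {(p : ℤ)} := by
    intro p
    have hp : Prime (p : ℤ) := Nat.prime_iff_prime_int.mp p.2
    haveI : (Ideal.span {(p : ℤ)}).IsPrime := (Ideal.span_singleton_prime hp.ne_zero).mpr hp
    obtain ⟨Q, -, hQ, hQp⟩ := Ideal.exists_ideal_over_prime_of_isIntegral
      (S := 𝓞 F) (Ideal.span {(p : ℤ)}) ⊥
      (by
        rw [← RingHom.ker_eq_comap_bot, (RingHom.injective_iff_ker_eq_bot _).mp hinj]
        exact bot_le)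
    refine ⟨⟨Q, hQ, fun hQbot => hp.ne_zero ?_⟩, hQp⟩
    have hmem : (p : ℤ) ∈ Q.comap (algebraMap ℤ (𝓞 F)) := by
      rw [hQp]
      exact Ideal.mem_span_singleton_self _
    rw [hQbot, Ideal.mem_comap, Ideal.mem_bot, map_eq_zero_iff _ hinj] at hmem
    exact hmem
  choose f hf using key
  refine Infinite.of_injective f fun p q hpq => ?_
  have h := hf p
  rw [hpq, hf q, Ideal.span_singleton_eq_span_singleton, Int.associated_iff_natAbs,
    Int.natAbs_natCast, Int.natAbs_natCast] at h
  exact Subtype.ext h.symm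

/-- **`hs₀` is redundant.** If `α`, `β` are unitary off a finite `S` (`|∏ α_w| = |∏ β_w| = 1`),
`card α_w = n > 0` off `S`, and `s₀ ∈ X` (`q_w^{1-s₀} α_w = β_w⁻¹` as multisets for almost all `w`),
then `Re s₀ = 1`: at one place `w ∉ S` where `X` holds, taking products and norms gives
`q_w^{(1 - Re s₀) n} = 1` with `q_w > 1`. So in `PairLPoleJS` the hypothesis `s₀.re = 1` is implied by
the others (with `card α_w = n` from `HasSatakeParamAt.card_eq`). [folklore] -/
theorem re_eq_one_of_satakeX {F : Type} [Field F] [NumberField F] {n : ℕ} (hn : 0 < n)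
    {S : Set (HeightOneSpectrum (𝓞 F))} (hS : S.Finite) {α β : HeightOneSpectrum (𝓞 F) → Multiset ℂ}
    (hcard : ∀ w ∉ S, Multiset.card (α w) = n)
    (hu : ∀ w ∉ S, ‖(α w).prod‖ = 1) (hu' : ∀ w ∉ S, ‖(β w).prod‖ = 1) {s₀ : ℂ}
    (hX : ∀ᶠ w in cofinite, (α w).map ((((w.residueCard : ℂ) ^ (1 - s₀))) * ·) = (β w).map (·⁻¹)) :
    s₀.re = 1 := by
  haveI := infinite_heightOneSpectrum_aux F
  obtain ⟨w, hXw, hwS⟩ := (hX.and hS.eventually_cofinite_notMem).exists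
  have hq1 : 1 < w.residueCard := w.one_lt_residueCard
  have hprod := congrArg Multiset.prod hXw
  rw [Multiset.prod_map_mul, Multiset.map_const', Multiset.prod_replicate, Multiset.map_id',
    Multiset.prod_map_inv, Multiset.map_id', hcard w hwS] at hprod
  have hnorm := congrArg norm hprod
  rw [norm_mul, norm_pow, norm_inv, hu w hwS, hu' w hwS, mul_one, inv_one,
    pow_eq_one_iff_of_nonneg (norm_nonneg _) hn.ne',
    Complex.norm_natCast_cpow_of_pos (lt_trans zero_lt_one hq1)] at hnorm
  have hlog := congrArg Real.log hnorm
  rw [Real.log_rpow (by exact_mod_cast lt_trans zero_lt_one hq1), Real.log_one, mul_eq_zero] at hlog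
  rcases hlog with h | h
  · rw [Complex.sub_re, Complex.one_re] at h
    linarith
  · have := Real.log_pos (by exact_mod_cast hq1 : (1 : ℝ) < w.residueCard)
    linarith

end Summit.Langlands.Langlands.Theorems.PairLPoleJS.Negative

end
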